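import Summits.CriticalPhenomena.SAWScalingLimit.Theorems.SAWTensorRGRestrictionOfLimitSqueezeKb
import Literature.Probability.RandomPlanarGeometry.CurveSpace
import Mathlib.Topology.Algebra.Order.Archimedean
import Mathlib.Data.Rat.Denumerable
import HarnessLib

/-!
# `stub_squeezeFamily`: separated exhausting outer squeezes of Jordan sub-domains exist

Support file (`--supports stmt-CriticalPhenomena-0773`, registered stub `stub_squeezeFamily`, the geometric
input F of composition 2 `RestrictionOfLimit_of_squeeze`) of the line `birth` for the crux `RestrictionOfLimit`
(shared verbatim by the routes SAWConePseudogroup / SAWConfRestriction / SAWBrownianDomination / SAWTowerCount /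
SAWTensorRG). Pure plane topology, no probability.

**Statement.** For Dobrushin domains `D' ⊆ D` with the same marked points `a, b` there is a family
`E : ℝ → DobrushinDomain` with, for `t > 0`, `D' ⊆ E t ⊆ D` and the marked points of `D`; SEPARATED,
`cl (E s) ∩ cl (D ∖ E t) = ∅` for `0 < s < t`; EXHAUSTING, `γ ⊆ cl (E t)` for all `t > 0` implies `γ ⊆ cl D'`.

**Construction.** Let `K = cl D'` and `Ψ : ℍ̄ → cl D ∖ {b}` a closed half-plane chart of `D` punctured at
`b` (part 4, `HChart`; Carathéodory + Schoenflies + Cayley). The pulled-back set `Kb = Ψ⁻¹ K ⊆ ℍ̄` is closed,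
connected, unbounded, with a real point (`Ψ⁻¹ a`). The reflected defect `Â = (ℍ̄ ∖ Kb) ∪ conj (ℍ ∖ Kb)`
(part 2, `hat Kb`) is open and symmetric; each of its components through a real point is a simply connected
symmetric domain carrying a symmetric chart onto the unit disc (part 2, symmetric Riemann map), whose closed
upper half-discs of radius `r` pull back to compact BITES `B r ⊆ comp ∩ ℍ̄` cut off by a simple arc with real
end-points, increasing in `r` with collars and exhausting the closed component as `r ↑ 1` (part 3,
`exists_biteData`). Every point of `ℍ̄ ∖ Kb` lies in such a component (`exists_real_mem_comp`: a component of
the defect not reaching the free boundary would be a bounded clopen piece of the connected unbounded exterior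
`ℂ ∖ cl D'` of the Jordan curve `∂D'` — Jordan curve theorem, tree). Enumerate the components by a dense
sequence of reals (first hits), and let `E t` (`0 < t < 1`) be `D` minus the `Ψ`-images of the bites of
radius `1 - t` of the first `⌊1/t⌋` components: finitely many pairwise disjoint cross-cut bites, so `E t` is a
Dobrushin domain with marked points `a, b` by the bite lemma (part 1, Newman's cross-cut theorem);
separation is the collar property transported by `Ψ` (`HChart.exists_nhds_inter_closure_subset`), exhaustion
is the exhaustion of each closed component plus density. For `t ≥ 1`, `E t = D`.
(The boundary loop of `E t` is `∂D` with finitely many arcs replaced by the cut images; no uniform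
convergence of parametrised loops is asserted here.)

References: M. H. A. Newman, *Elements of the topology of plane sets of points* (1939), Ch. V §11;
Ch. Pommerenke, *Boundary Behaviour of Conformal Maps* (1992), §2; G. F. Lawler, O. Schramm, W. Werner,
*Conformal restriction: the chordal case* (2003), §2 (hull sub-domains). Axioms `propext`, `Classical.choice`,
`Quot.sound`; named facts only through discharged `_holds` theorems (Jordan curve theorem, Newman, Riemann
mapping with uniqueness, Carathéodory, Schoenflies).
-/

noncomputable section

open MeasureTheory Filter Topology Set Metric Complex Bornology
open scoped ComplexConjugate
open Literature.Probability.RandomPlanarGeometry Literature.Topology.PlaneTopology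

namespace Summit.CriticalPhenomena.SAWScalingLimit.Theorems.RestrictionOfLimit.Birth

section Main

variable {D D' : DobrushinDomain} (χ : HChart D.toJordanDomain (D.pt 1)) {Kb : Set ℂ}
  (hKb : Kb = {z : ℂ | 0 ≤ z.im ∧ χ.Ψ z ∈ closure D'.carrier})

/-! ### The squeeze -/

include hKb in
/-- **The squeeze, from bite data.** Given a dense real sequence `xs` and bite data on the component of every
`xs n ∉ Kb`, the family `E t = D ∖ Ψ(⋃ {bites of radius 1 - t of the first ⌊1/t⌋ representatives})`
(`0 < t < 1`; `E t = D` otherwise) is a separated exhausting outer squeeze of `D'` inside `D`. [folklore] -/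
theorem squeeze_main (hsub : D'.carrier ⊆ D.carrier) (h0 : D'.pt 0 = D.pt 0) (h1 : D'.pt 1 = D.pt 1)
    (xs : ℕ → ℝ) (hxs : DenseRange xs) (B Bi A : ℕ → ℝ → Set ℂ) (u v : ℕ → ℝ → ℂ)
    (hdata : ∀ n : ℕ, (xs n : ℂ) ∉ Kb →
      (∀ r : ℝ, 0 < r → r < 1 →
        IsCompact (B n r) ∧ B n r ⊆ comp Kb (xs n) ∩ {z | 0 ≤ z.im} ∧ A n r ⊆ B n r ∧
        IsSimpleArc (A n r) (u n r) (v n r) ∧ (u n r).im = 0 ∧ (v n r).im = 0 ∧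
        u n r ∈ closure (Bi n r) ∧ v n r ∈ closure (Bi n r) ∧
        (B n r ∩ {z | 0 < z.im}) \ A n r = Bi n r ∧ IsOpen (Bi n r) ∧ IsConnected (Bi n r) ∧
        Bi n r ⊆ {z | 0 < z.im} ∧ (∀ z ∈ A n r, z.im = 0 → z = u n r ∨ z = v n r) ∧
        (∀ r' : ℝ, r < r' → r' < 1 → ∀ z ∈ B n r, ∃ V : Set ℂ, IsOpen V ∧ z ∈ V ∧
          V ∩ {w | 0 ≤ w.im} ⊆ B n r')) ∧
      (∀ z ∈ comp Kb (xs n), 0 ≤ z.im → ∃ r₀ : ℝ, r₀ < 1 ∧ ∀ r' : ℝ, r₀ < r' → r' < 1 →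
        ∃ V : Set ℂ, IsOpen V ∧ z ∈ V ∧ V ∩ {w | 0 ≤ w.im} ⊆ B n r')) :
    ∃ E : ℝ → DobrushinDomain,
      (∀ t : ℝ, 0 < t → D'.carrier ⊆ (E t).carrier ∧ (E t).carrier ⊆ D.carrier ∧
        (E t).pt 0 = D.pt 0 ∧ (E t).pt 1 = D.pt 1) ∧
      (∀ s t : ℝ, 0 < s → s < t → closure (E s).carrier ∩ closure (D.carrier \ (E t).carrier) = ∅) ∧
      (∀ w : ℂ, (∀ t : ℝ, 0 < t → w ∈ closure (E t).carrier) → w ∈ closure D'.carrier) := by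
  classical
  have hK : IsClosed Kb := isClosed_kb χ hKb
  -- representatives, finite active sets, model bites
  set rep : ℕ → Prop := fun n ↦ (xs n : ℂ) ∉ Kb ∧
    ∀ m < n, (xs m : ℂ) ∉ Kb → comp Kb (xs m) ≠ comp Kb (xs n) with hrep
  set Sf : ℝ → Finset ℕ := fun t ↦ (Finset.range ⌊1 / t⌋₊).filter rep with hSf
  set Tm : ℝ → Set ℂ := fun t ↦ ⋃ n ∈ Sf t, B n (1 - t) with hTm
  have hmemSf : ∀ {t : ℝ} {n : ℕ}, n ∈ Sf t ↔ n < ⌊1 / t⌋₊ ∧ rep n := by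
    intro t n; simp [hSf]
  have hcomp_ne : ∀ {n m : ℕ}, rep n → rep m → n ≠ m → comp Kb (xs n) ≠ comp Kb (xs m) := by
    intro n m hn hm hnm
    rcases lt_or_gt_of_ne hnm with h | h
    · exact hm.2 n h hn.1
    · exact fun heq ↦ hn.2 m h hm.1 heq.symm
  have hmemTm : ∀ {t : ℝ} {z : ℂ}, z ∈ Tm t ↔ ∃ n ∈ Sf t, z ∈ B n (1 - t) := by
    intro t z; simp only [hTm, mem_iUnion, exists_prop]
  have hTmK : ∀ {t : ℝ}, 0 < t → t < 1 → ∀ z ∈ Tm t, 0 ≤ z.im ∧ z ∉ Kb := by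
    intro t ht ht1 z hz
    obtain ⟨n, hn, hzn⟩ := hmemTm.1 hz
    have hzB := ((hdata n (hmemSf.1 hn).2.1).1 (1 - t) (by linarith) (by linarith)).2.1 hzn
    exact ⟨hzB.2, (mem_hat_iff_of_im_nonneg hzB.2).1 (comp_subset _ hzB.1)⟩
  have hclosedBD : ∀ {t : ℝ}, 0 < t → t < 1 → IsClosed (χ.Ψ '' Tm t) := by
    intro t ht ht1
    have hcpt : IsCompact (Tm t) := (Sf t).isCompact_biUnion fun n hn ↦
      ((hdata n (hmemSf.1 hn).2.1).1 (1 - t) (by linarith) (by linarith)).1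
    exact (hcpt.image_of_continuousOn (χ.continuousOn.mono fun z hz ↦ (hTmK ht ht1 z hz).1)).isClosed
  -- one level
  have hlevel : ∀ t : ℝ, 0 < t → t < 1 → ∃ E : DobrushinDomain,
      E.carrier = D.carrier \ χ.Ψ '' Tm t ∧ E.pt 0 = D.pt 0 ∧ E.pt 1 = D.pt 1 := by
    intro t ht ht1
    refine exists_dobrushin_level χ hKb h0 (Sf t) xs (fun n ↦ B n (1 - t)) (fun n ↦ Bi n (1 - t))
      (fun n ↦ A n (1 - t)) (fun n ↦ u n (1 - t)) (fun n ↦ v n (1 - t))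
      (fun n hn m hm hnm ↦ hcomp_ne (hmemSf.1 hn).2 (hmemSf.1 hm).2 hnm) fun n hn ↦ ?_
    obtain ⟨c1, c2, c3, c4, c5, c6, c7, c8, c9, c10, c11, c12, c13, -⟩ :=
      (hdata n (hmemSf.1 hn).2.1).1 (1 - t) (by linarith) (by linarith)
    exact ⟨c1, c2, c3, c4, c5, c6, c7, c8, c9, c10, c11, c12, c13⟩
  choose! Ef hEf using hlevel
  set E : ℝ → DobrushinDomain := fun t ↦ if 0 < t ∧ t < 1 then Ef t else D with hE_def
  have hpos : ∀ {t : ℝ}, 0 < t → t < 1 → E t = Ef t := fun {t} ht ht1 ↦ by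
    show (if 0 < t ∧ t < 1 then Ef t else D) = Ef t
    exact if_pos ⟨ht, ht1⟩
  have hneg : ∀ {t : ℝ}, ¬ t < 1 → E t = D := fun {t} ht1 ↦ by
    show (if 0 < t ∧ t < 1 then Ef t else D) = D
    exact if_neg fun h ↦ ht1 h.2
  -- `D' ∩ Ψ(Tm t) = ∅`
  have hD'T : ∀ {t : ℝ}, 0 < t → t < 1 → ∀ z ∈ D'.carrier, z ∉ χ.Ψ '' Tm t := by
    rintro t ht ht1 _ hzD' ⟨y, hy, rfl⟩
    exact (hTmK ht ht1 y hy).2 ((mem_kb_iff χ hKb).2 ⟨(hTmK ht ht1 y hy).1, subset_closure hzD'⟩)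
  refine ⟨E, fun t ht ↦ ?_, fun s t hs hst ↦ ?_, fun w hw ↦ ?_⟩
  · -- containment and marked points
    by_cases ht1 : t < 1
    · rw [hpos ht ht1, (hEf t ht ht1).1]
      exact ⟨fun z hz ↦ ⟨hsub hz, hD'T ht ht1 z hz⟩, sdiff_subset, (hEf t ht ht1).2.1, (hEf t ht ht1).2.2⟩
    · rw [hneg ht1]
      exact ⟨hsub, Subset.rfl, rfl, rfl⟩
  · -- separation
    by_cases ht1 : t < 1
    · have ht : 0 < t := hs.trans hst
      have hs1 : s < 1 := hst.trans ht1
      rw [hpos hs hs1, hpos ht ht1, (hEf s hs hs1).1, (hEf t ht ht1).1, sdiff_sdiff_right_self,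
        eq_empty_iff_forall_notMem]
      rintro w ⟨hws, hwt⟩
      have hwT : w ∈ χ.Ψ '' Tm t := closure_minimal inter_subset_right (hclosedBD ht ht1) hwt
      obtain ⟨z, hz, rfl⟩ := hwT
      obtain ⟨n, hn, hzn⟩ := hmemTm.1 hz
      have hnS : n ∈ Sf s := by
        refine hmemSf.2 ⟨lt_of_lt_of_le (hmemSf.1 hn).1 (Nat.floor_mono ?_), (hmemSf.1 hn).2⟩
        exact one_div_le_one_div_of_le hs hst.le
      obtain ⟨V, hVo, hzV, hVB⟩ := ((hdata n (hmemSf.1 hn).2.1).1 (1 - t) (by linarith) (by linarith)).2.2.2.2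
        |>.2.2.2.2.2.2.2.2.2 (1 - s) (by linarith) (by linarith) z hzn
      obtain ⟨O, hO, hOsub⟩ := χ.exists_nhds_inter_closure_subset (hTmK ht ht1 z hz).1 (hVo.mem_nhds hzV)
      obtain ⟨y, hyO, hyD, hyB⟩ := mem_closure_iff_nhds.1 hws O hO
      obtain ⟨y', hy', rfl⟩ := hOsub ⟨hyO, subset_closure hyD⟩
      exact hyB ⟨y', hmemTm.2 ⟨n, hnS, hVB hy'⟩, rfl⟩
    · rw [hneg ht1, sdiff_self, closure_empty, inter_empty]
  · -- exhaustion
    by_contra hwK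
    have h12 : (0 : ℝ) < 1 / 2 := by norm_num
    have h12' : (1 / 2 : ℝ) < 1 := by norm_num
    have hwD : w ∈ closure D.carrier := by
      have := hw (1 / 2) h12
      rw [hpos h12 h12', (hEf _ h12 h12').1] at this
      exact closure_mono sdiff_subset this
    have hwb : w ≠ D.pt 1 := fun h ↦ hwK (by rw [h, ← h1]; exact (pt_mem_frontier' D' 1).1.1)
    set z := χ.Ψinv w with hz_def
    have hz : 0 ≤ z.im := χ.mapsTo_inv ⟨hwD, hwb⟩
    have hzw : χ.Ψ z = w := χ.right_inv w ⟨hwD, hwb⟩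
    have hzK : z ∉ Kb := fun h ↦ hwK (hzw ▸ ((mem_kb_iff χ hKb).1 h).2)
    obtain ⟨x, hx, hzx⟩ := exists_real_mem_comp χ hKb h1 hz hzK
    -- a member of the dense sequence in the component of `z`
    have hopen : IsOpen {y : ℝ | (y : ℂ) ∈ comp Kb x} := (isOpen_comp hK x).preimage continuous_ofReal
    obtain ⟨m, hm⟩ := hxs.exists_mem_open hopen ⟨x, mem_connectedComponentIn hx⟩
    have hex : ∃ n : ℕ, (xs n : ℂ) ∉ Kb ∧ z ∈ comp Kb (xs n) := by
      refine ⟨m, (mem_hat_iff_of_im_nonneg (by simp)).1 (comp_subset x hm), ?_⟩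
      rw [comp, ← connectedComponentIn_eq hm]
      exact hzx
    set n := Nat.find hex with hn_def
    have hn : (xs n : ℂ) ∉ Kb ∧ z ∈ comp Kb (xs n) := Nat.find_spec hex
    have hrepn : rep n := by
      refine ⟨hn.1, fun m' hm' hgood heq ↦ Nat.find_min hex hm' ⟨hgood, ?_⟩⟩
      rw [heq]
      exact hn.2
    obtain ⟨r₀, hr₀1, hexh⟩ := (hdata n hn.1).2 z hn.2 hz
    -- the level `t`
    set t : ℝ := min (1 / ((n : ℝ) + 2)) ((1 - r₀) / 2) with ht_def
    have hn2 : (0 : ℝ) < (n : ℝ) + 2 := by positivity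
    have ht0 : 0 < t := lt_min (by positivity) (by linarith)
    have ht1 : t < 1 := by
      have : 1 / ((n : ℝ) + 2) < 1 := (div_lt_one hn2).2 (by linarith)
      exact (min_le_left _ _).trans_lt this
    have htr : r₀ < 1 - t := by
      have := min_le_right (1 / ((n : ℝ) + 2)) ((1 - r₀) / 2)
      linarith
    have hnlt : n < ⌊1 / t⌋₊ := by
      have h1t : (n : ℝ) + 2 ≤ 1 / t := by
        have := one_div_le_one_div_of_le ht0 (min_le_left (1 / ((n : ℝ) + 2)) ((1 - r₀) / 2))
        rwa [one_div_one_div] at this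
      have : n + 1 ≤ ⌊1 / t⌋₊ := Nat.le_floor (by push_cast; linarith)
      omega
    have hnSf : n ∈ Sf t := hmemSf.2 ⟨hnlt, hrepn⟩
    obtain ⟨V, hVo, hzV, hVB⟩ := hexh (1 - t) htr (by linarith)
    obtain ⟨O, hO, hOsub⟩ := χ.exists_nhds_inter_closure_subset hz (hVo.mem_nhds hzV)
    rw [hzw] at hO
    have hwt := hw t ht0
    rw [hpos ht0 ht1, (hEf t ht0 ht1).1] at hwt
    obtain ⟨y, hyO, hyD, hyB⟩ := mem_closure_iff_nhds.1 hwt O hO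
    obtain ⟨y', hy', rfl⟩ := hOsub ⟨hyO, subset_closure hyD⟩
    exact hyB ⟨y', hmemTm.2 ⟨n, hnSf, hVB hy'⟩, rfl⟩

end Main

/-! ### The registered stub -/

/-- **Registered stub `stub_squeezeFamily` (geometry F of composition 2 `RestrictionOfLimit_of_squeeze`,
line `birth`) — separated exhausting outer squeezes exist.** For Dobrushin domains `D' ⊆ D` with the same
marked points there is `E : ℝ → DobrushinDomain` with, for `t > 0`, `D' ⊆ E t ⊆ D` and the marked points of
`D`, separated (`cl (E s) ∩ cl (D ∖ E t) = ∅` for `0 < s < t`) and exhausting (`γ ⊆ cl (E t)` for all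
`t > 0` implies `γ ⊆ cl D'`). Construction in the module docstring. [folklore] -/
theorem stub_squeezeFamily :
    ∀ (D D' : DobrushinDomain), D'.carrier ⊆ D.carrier → D'.pt 0 = D.pt 0 → D'.pt 1 = D.pt 1 →
      ∃ E : ℝ → DobrushinDomain,
        (∀ t : ℝ, 0 < t → D'.carrier ⊆ (E t).carrier ∧ (E t).carrier ⊆ D.carrier ∧
          (E t).pt 0 = D.pt 0 ∧ (E t).pt 1 = D.pt 1) ∧
        (∀ s t : ℝ, 0 < s → s < t → closure (E s).carrier ∩ closure (D.carrier \ (E t).carrier) = ∅) ∧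
        (∀ γ : CurveClass ℂ, (∀ t : ℝ, 0 < t → γ.range ⊆ closure (E t).carrier) →
          γ.range ⊆ closure D'.carrier) := by
  intro D D' hsub h0 h1
  classical
  obtain ⟨χ⟩ := nonempty_hChart D.toJordanDomain (b := D.pt 1) (D.boundary_mem_frontier _)
  set Kb : Set ℂ := {z : ℂ | 0 ≤ z.im ∧ χ.Ψ z ∈ closure D'.carrier} with hKb
  have hK : IsClosed Kb := isClosed_kb χ hKb
  have hKH : Kb ⊆ {z | 0 ≤ z.im} := kb_subset χ hKb
  have hKc : IsPreconnected Kb := isPreconnected_kb χ hKb hsub h1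
  have hunb : ¬ IsBounded Kb := not_isBounded_kb χ hKb hsub h1
  have hreal : ∃ x : ℝ, (x : ℂ) ∈ Kb := exists_real_mem_kb χ hKb h0
  -- a dense sequence of reals
  set xs : ℕ → ℝ := fun n ↦ (((Denumerable.eqv ℚ).symm n : ℚ) : ℝ) with hxs_def
  have hxs : DenseRange xs :=
    Rat.denseRange_cast.comp (Denumerable.eqv ℚ).symm.surjective.denseRange Rat.continuous_coe_real
  -- bite data on every component through a member of the sequence
  have hdata' : ∀ n : ℕ, ∃ (B Bi L : ℝ → Set ℂ) (p q : ℝ → ℂ), (xs n : ℂ) ∉ Kb →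
      (∀ r : ℝ, 0 < r → r < 1 →
        IsCompact (B r) ∧ B r ⊆ comp Kb (xs n) ∩ {z | 0 ≤ z.im} ∧ L r ⊆ B r ∧
        IsSimpleArc (L r) (p r) (q r) ∧ (p r).im = 0 ∧ (q r).im = 0 ∧ p r ∈ closure (Bi r) ∧
        q r ∈ closure (Bi r) ∧ (B r ∩ {z | 0 < z.im}) \ L r = Bi r ∧ IsOpen (Bi r) ∧
        IsConnected (Bi r) ∧ Bi r ⊆ {z | 0 < z.im} ∧ (∀ z ∈ L r, z.im = 0 → z = p r ∨ z = q r) ∧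
        (∀ r' : ℝ, r < r' → r' < 1 → ∀ z ∈ B r, ∃ V : Set ℂ, IsOpen V ∧ z ∈ V ∧
          V ∩ {w | 0 ≤ w.im} ⊆ B r')) ∧
      (∀ z ∈ comp Kb (xs n), 0 ≤ z.im → ∃ r₀ : ℝ, r₀ < 1 ∧ ∀ r' : ℝ, r₀ < r' → r' < 1 →
        ∃ V : Set ℂ, IsOpen V ∧ z ∈ V ∧ V ∩ {w | 0 ≤ w.im} ⊆ B r') := by
    intro n
    by_cases hgood : (xs n : ℂ) ∈ Kb
    · exact ⟨fun _ ↦ ∅, fun _ ↦ ∅, fun _ ↦ ∅, fun _ ↦ 0, fun _ ↦ 0, fun h ↦ absurd hgood h⟩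
    · obtain ⟨B, Bi, L, p, q, h⟩ := exists_biteData hK hKH hKc hunb hreal
        ((mem_hat_iff_of_im_nonneg (by simp)).2 hgood)
      exact ⟨B, Bi, L, p, q, fun _ ↦ h⟩
  choose B Bi L p q hdata using hdata'
  obtain ⟨E, hE1, hE2, hE3⟩ := squeeze_main χ hKb hsub h0 h1 xs hxs B Bi L p q hdata
  exact ⟨E, hE1, hE2, fun γ hγ w hw ↦ hE3 w fun t ht ↦ hγ t ht hw⟩

end Summit.CriticalPhenomena.SAWScalingLimit.Theorems.RestrictionOfLimit.Birth

end
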